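import Summits.KontsevichZagierPeriods.KontsevichZagierPeriods.Theorems.K2SymbolChainsJensenIsScissorsRadialCore1

/-!
# Jensen is scissors — the radial step, core (part 2): the band equals `log (1 + ρ)²` modulo scissors

Support file for item stmt-KontsevichZagierPeriods-5204 (`JensenIsScissors`, route
KontsevichZagierPeriods/K2SymbolChains). Over the base `T' = {(x, s) | x ∈ B, s ≠ 0}` (`0 < ρ < 1`
on `B`, `ρ` differentiable, `h` and `h log ρ` integrable) let `G = h(x)/(1 + s²)`,
`W_r(s) = ((1 − r)² + (1 + r)² s²)/(1 + s²)` and `M = (1 + ρ)²`. The band representation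
`[{W_{ρ²} < u < M W_ρ}, G/u]` and the unfolding `[{1 < u < M}, G/u]` of `G log M` differ by an
element of any subgroup `S` containing the three scissors move sets. Chain (all in dimension
`n + 2`, coordinates `(x, s, r)` / `(x, s, u)`): pull the band back along the monotone path
`u = F(r) = ((1 − ρ²)/(1 − r))² W_r(s)`, `r ∈ (ρ², ρ)` (rule 2)), obtaining the integrand
`G ∂ᵣ log F = 2G/(1 − r) + G/r − h c/((1 + c²s²) r)`, `c = (1 + r)/(1 − r)` (file `RadialAux`);
split it (rule 1b)); `[2G/(1 − r)]` is the pull-back of `[{1 < u < M}, G/u]` along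
`u = ((1 − ρ²)/(1 − r))²`, `[G/r]` that of the unfolding of `G log (1/ρ)` along `u = r/ρ²`
(rule 2)), and `[h c/((1 + c² s²) r)]` is carried onto `[G/r]` by the dilation `s ↦ c(r) s`
(rule 2) after swapping the coordinates `s`, `r`, a permutation move). [Kontsevich–Zagier 2001,
§1.2, rules 1)–2)] [folklore]
-/

noncomputable section

open MeasureTheory Set
open Literature.NumberTheory.Transcendental Literature.ModelTheory.ExponentialFields

namespace Summit.KontsevichZagierPeriods.K2SymbolChains.JensenIsScissorsProof

open Literature.NumberTheory.Transcendental.KZ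

variable {n : ℕ} {S : AddSubgroup FormalRep}

/-- Reindexing moves lie in `S`. [Kontsevich–Zagier 2001, §1.2, rule 2)] [folklore] -/
theorem of_sub_of_reindex_mem (hS : domainAddRel ∪ integrandAddRel ∪ changeOfVariablesRel ⊆ S)
    {N : ℕ} (r : IntegralRep N) (p : Equiv.Perm (Fin N)) : of r - of (r.reindex p) ∈ S :=
  levelRel_le hS (permRel_subset_levelRel (of_sub_of_reindex_mem_permRel r p))

/-- **The radial step, core.** See the module docstring. [Kontsevich–Zagier 2001, §1.2] [folklore] -/
theorem radial_core (hS : domainAddRel ∪ integrandAddRel ∪ changeOfVariablesRel ⊆ S)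
    {B : Set (Fin n → ℝ)} {h ρ : (Fin n → ℝ) → ℝ}
    (hB : IsSemialgebraic ℚ B) (hh : IsSemialgebraicFunOn ℚ B h) (hρs : IsSemialgebraicFunOn ℚ B ρ)
    (hρ0 : ∀ x ∈ B, 0 < ρ x) (hρ1 : ∀ x ∈ B, ρ x < 1) (hρd : ∀ x ∈ B, DifferentiableAt ℝ ρ x)
    (hhlog : IntegrableOn (fun x => h x * Real.log (ρ x)) B)
    (Rband LM : IntegralRep (n + 1 + 1))
    (hBd : Rband.domain = {z : Fin (n + 1 + 1) → ℝ |
      Fin.init z ∈ {b : Fin (n + 1) → ℝ | Fin.init b ∈ B ∧ b (Fin.last n) ≠ 0} ∧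
      ((1 - ρ (Fin.init (Fin.init z)) ^ 2) ^ 2 + (1 + ρ (Fin.init (Fin.init z)) ^ 2) ^ 2 *
          (Fin.init z) (Fin.last n) ^ 2) / (1 + (Fin.init z) (Fin.last n) ^ 2) < z (Fin.last (n + 1)) ∧
      z (Fin.last (n + 1)) < (1 + ρ (Fin.init (Fin.init z))) ^ 2 *
        (((1 - ρ (Fin.init (Fin.init z))) ^ 2 + (1 + ρ (Fin.init (Fin.init z))) ^ 2 *
          (Fin.init z) (Fin.last n) ^ 2) / (1 + (Fin.init z) (Fin.last n) ^ 2))})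
    (hBi : Rband.integrand = fun z => (h (Fin.init (Fin.init z)) / (1 + (Fin.init z) (Fin.last n) ^ 2)) /
      z (Fin.last (n + 1)))
    (hMd : LM.domain = logUnfoldDomain {b : Fin (n + 1) → ℝ | Fin.init b ∈ B ∧ b (Fin.last n) ≠ 0}
      (fun b => (1 + ρ (Fin.init b)) ^ 2))
    (hMi : LM.integrand = logUnfoldIntegrand (fun b => h (Fin.init b) / (1 + b (Fin.last n) ^ 2))) :
    of Rband - of LM ∈ S := by
  -- notation
  set T' : Set (Fin (n + 1) → ℝ) := {b | Fin.init b ∈ B ∧ b (Fin.last n) ≠ 0} with hT'_def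
  set G : (Fin (n + 1) → ℝ) → ℝ := fun b => h (Fin.init b) / (1 + b (Fin.last n) ^ 2) with hG_def
  set W : (Fin (n + 1) → ℝ) → ℝ := fun b =>
    ((1 - ρ (Fin.init b)) ^ 2 + (1 + ρ (Fin.init b)) ^ 2 * b (Fin.last n) ^ 2) / (1 + b (Fin.last n) ^ 2)
    with hW_def
  set W₂ : (Fin (n + 1) → ℝ) → ℝ := fun b =>
    ((1 - ρ (Fin.init b) ^ 2) ^ 2 + (1 + ρ (Fin.init b) ^ 2) ^ 2 * b (Fin.last n) ^ 2) /
      (1 + b (Fin.last n) ^ 2) with hW₂_def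
  set M : (Fin (n + 1) → ℝ) → ℝ := fun b => (1 + ρ (Fin.init b)) ^ 2 with hM_def
  -- the path `F` on `E = {(b, r) | b ∈ T', ρ² < r < ρ}` and its endpoints
  set Ff : (Fin (n + 1 + 1) → ℝ) → ℝ := fun z =>
    (1 - ρ (Fin.init (Fin.init z)) ^ 2) ^ 2 * ((1 - z (Fin.last (n + 1))) ^ 2 +
      (1 + z (Fin.last (n + 1))) ^ 2 * (Fin.init z) (Fin.last n) ^ 2) /
      ((1 - z (Fin.last (n + 1))) ^ 2 * (1 + (Fin.init z) (Fin.last n) ^ 2)) with hFf_def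
  set p : (Fin (n + 1) → ℝ) → ℝ := fun b => ρ (Fin.init b) ^ 2 with hp_def
  set q : (Fin (n + 1) → ℝ) → ℝ := fun b => ρ (Fin.init b) with hq_def
  set E : Set (Fin (n + 1 + 1) → ℝ) := {z | Fin.init z ∈ T' ∧ p (Fin.init z) < z (Fin.last (n + 1)) ∧
    z (Fin.last (n + 1)) < q (Fin.init z)} with hE_def
  -- basic facts
  have hT : IsSemialgebraic ℚ {b : Fin (n + 1) → ℝ | Fin.init b ∈ B} := isSemialgebraic_cyl hB
  have hsT := isSemialgebraicFunOn_apply hT (Fin.last n)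
  have hT's : IsSemialgebraic ℚ T' := hsT.isSemialgebraic_sep_ne_zero
  have hT'B : T' ⊆ {b : Fin (n + 1) → ℝ | Fin.init b ∈ B} := fun b hb => hb.1
  have hps : IsSemialgebraicFunOn ℚ T' p :=
    ((IsSemialgebraicFunOn.mul_holds hρs hρs).comp_init.mono hT'B hT's).congr fun b _ => by
      simp only [hp_def, Pi.mul_apply, sq]
  have hqs : IsSemialgebraicFunOn ℚ T' q := hρs.comp_init.mono hT'B hT's
  have hpq : ∀ b ∈ T', p b ≤ q b := fun b hb => by
    have h0 := hρ0 _ hb.1; have h1 := hρ1 _ hb.1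
    simp only [hp_def, hq_def]; nlinarith
  have hEs : IsSemialgebraic ℚ E := isSemialgebraic_oband hps hqs
  have hGT' : IsSemialgebraicFunOn ℚ T' G := isSemialgebraicFunOn_weight hh hT's hT'B
  have hMs : IsSemialgebraicFunOn ℚ T' M := by
    have h1 := IsSemialgebraicFunOn.add_holds (isSemialgebraicFunOn_ratCast hT's 1) hqs
    exact (IsSemialgebraicFunOn.mul_holds h1 h1).congr fun b _ => by simp [hM_def, hq_def, sq]
  have hM1 : ∀ b ∈ T', 1 ≤ M b := fun b hb => by
    have := hρ0 _ hb.1; simp only [hM_def]; nlinarith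
  -- facts on `E`: write `x = init (init z)`, `s = (init z) last`, `r = z last`
  have hEx : ∀ z ∈ E, Fin.init (Fin.init z) ∈ B := fun z hz => hz.1.1
  have hEs0 : ∀ z ∈ E, (Fin.init z) (Fin.last n) ≠ 0 := fun z hz => hz.1.2
  have hEr0 : ∀ z ∈ E, 0 < z (Fin.last (n + 1)) := fun z hz =>
    lt_trans (by have := hρ0 _ hz.1.1; simp only [hp_def]; positivity) hz.2.1
  have hEr1 : ∀ z ∈ E, z (Fin.last (n + 1)) < 1 := fun z hz => hz.2.2.trans (hρ1 _ hz.1.1)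
  -- semialgebraic atoms on `E`
  have hρE : IsSemialgebraicFunOn ℚ E (fun z => ρ (Fin.init (Fin.init z))) :=
    hρs.comp_init.comp_init.mono (fun z hz => hEx z hz) hEs
  have hhE : IsSemialgebraicFunOn ℚ E (fun z => h (Fin.init (Fin.init z))) :=
    hh.comp_init.comp_init.mono (fun z hz => hEx z hz) hEs
  have hsE : IsSemialgebraicFunOn ℚ E (fun z : Fin (n + 1 + 1) → ℝ => (Fin.init z) (Fin.last n)) :=
    (isSemialgebraicFunOn_apply hEs (Fin.castSucc (Fin.last n))).congr fun z _ => by simp [Fin.init]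
  have hrE : IsSemialgebraicFunOn ℚ E (fun z : Fin (n + 1 + 1) → ℝ => z (Fin.last (n + 1))) :=
    isSemialgebraicFunOn_apply hEs (Fin.last (n + 1))
  have h1E := isSemialgebraicFunOn_ratCast hEs 1
  have h2E := isSemialgebraicFunOn_ratCast hEs 2
  have h1s2 : IsSemialgebraicFunOn ℚ E (fun z : Fin (n + 1 + 1) → ℝ => 1 + (Fin.init z) (Fin.last n) ^ 2) :=
    (IsSemialgebraicFunOn.add_holds h1E (IsSemialgebraicFunOn.mul_holds hsE hsE)).congr fun z _ => by simp [sq]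
  have h1mr : IsSemialgebraicFunOn ℚ E (fun z : Fin (n + 1 + 1) → ℝ => 1 - z (Fin.last (n + 1))) :=
    (IsSemialgebraicFunOn.sub_holds h1E hrE).congr fun z _ => by simp
  have h1pr : IsSemialgebraicFunOn ℚ E (fun z : Fin (n + 1 + 1) → ℝ => 1 + z (Fin.last (n + 1))) :=
    (IsSemialgebraicFunOn.add_holds h1E hrE).congr fun z _ => by simp
  have hcE : IsSemialgebraicFunOn ℚ E (fun z : Fin (n + 1 + 1) → ℝ =>
      (1 + z (Fin.last (n + 1))) / (1 - z (Fin.last (n + 1)))) :=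
    IsSemialgebraicFunOn.div h1pr h1mr fun z hz => by have := hEr1 z hz; exact by linarith
  -- differentiable atoms at points of `E`
  have hdiff_atoms : ∀ z ∈ E,
      DifferentiableAt ℝ (fun z : Fin (n + 1 + 1) → ℝ => ρ (Fin.init (Fin.init z))) z ∧
      DifferentiableAt ℝ (fun z : Fin (n + 1 + 1) → ℝ => (Fin.init z) (Fin.last n)) z ∧
      DifferentiableAt ℝ (fun z : Fin (n + 1 + 1) → ℝ => z (Fin.last (n + 1))) z := by
    intro z hz
    have hi1 : DifferentiableAt ℝ (fun w : Fin (n + 1 + 1) → ℝ => Fin.init w) z :=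
      (ContinuousLinearMap.pi fun j => ContinuousLinearMap.proj (R := ℝ)
        (φ := fun _ : Fin (n + 1 + 1) => ℝ) (Fin.castSucc j)).differentiableAt
    have hi2 : DifferentiableAt ℝ (fun w : Fin (n + 1) → ℝ => Fin.init w) (Fin.init z) :=
      (ContinuousLinearMap.pi fun j => ContinuousLinearMap.proj (R := ℝ)
        (φ := fun _ : Fin (n + 1) => ℝ) (Fin.castSucc j)).differentiableAt
    refine ⟨((hρd _ (hEx z hz)).comp _ hi2).comp z hi1, ?_, differentiableAt_apply (𝕜 := ℝ) _ z⟩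
    exact (differentiableAt_apply (𝕜 := ℝ) (Fin.last n) (Fin.init z)).comp z hi1
  obtain ⟨Rfull, Q₁, hRfd, hRfi, eFull, hQ₁d, hQ₁i, eQ₁⟩ :=
    radial_pullbacks hS hB hh hρs hρ0 hρ1 hρd Rband LM hBd hBi hMd hMi
  set fR : (Fin (n + 1 + 1) → ℝ) → ℝ := (fun z : Fin (n + 1 + 1) → ℝ =>
    h (Fin.init (Fin.init z)) * (2 / (1 - z (Fin.last (n + 1))) / (1 + (Fin.init z) (Fin.last n) ^ 2)) +
    h (Fin.init (Fin.init z)) / (1 + (Fin.init z) (Fin.last n) ^ 2) / z (Fin.last (n + 1)) -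
    h (Fin.init (Fin.init z)) * ((1 + z (Fin.last (n + 1))) / (1 - z (Fin.last (n + 1)))) /
      ((1 + ((1 + z (Fin.last (n + 1))) / (1 - z (Fin.last (n + 1)))) ^ 2 * (Fin.init z) (Fin.last n) ^ 2) *
        z (Fin.last (n + 1)))) with hfR_def
  set f₁ : (Fin (n + 1 + 1) → ℝ) → ℝ := (fun z : Fin (n + 1 + 1) → ℝ =>
    h (Fin.init (Fin.init z)) / (1 + (Fin.init z) (Fin.last n) ^ 2) * (2 / (1 - z (Fin.last (n + 1))))) with hf₁_def
  have hf₁s : IsSemialgebraicFunOn ℚ E f₁ :=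
    IsSemialgebraicFunOn.mul_holds (IsSemialgebraicFunOn.div hhE h1s2 fun z _ => by positivity)
      (IsSemialgebraicFunOn.div h2E h1mr fun z hz => by have := hEr1 z hz; exact by linarith)
  ----------------------------------------------------------------
  -- C3: `[G/r]` is the pull-back of the unfolding of `G log (1/ρ)` along `u = r/ρ²`
  ----------------------------------------------------------------
  have hinvs : IsSemialgebraicFunOn ℚ T' (fun b => (ρ (Fin.init b))⁻¹) := hqs.inv fun b hb => (hρ0 _ hb.1).ne'
  have hinv1 : ∀ b ∈ T', 1 ≤ (ρ (Fin.init b))⁻¹ := fun b hb =>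
    (one_le_inv₀ (hρ0 _ hb.1)).2 (hρ1 _ hb.1).le
  have hGlogInv : IntegrableOn (fun b => G b * Real.log ((ρ (Fin.init b))⁻¹)) T' := by
    have := integrableOn_cyl_mul (B := B) (f := fun x => h x * Real.log (ρ x)) (g := fun s : ℝ => (1 + s ^ 2)⁻¹)
      hhlog integrable_inv_one_add_sq
    refine (this.mono_set hT'B).neg.congr_fun (fun b _ => ?_) (IsSemialgebraic.measurableSet_holds hT's)
    simp only [hG_def, Real.log_inv, Pi.neg_apply]
    ring
  set LInv : IntegralRep (n + 1 + 1) := logUnfoldRep T' (fun b => (ρ (Fin.init b))⁻¹) G hT's hGT' hinvs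
    (fun b hb => zero_le_one.trans (hinv1 b hb))
    (by
      rw [show {b | b ∈ T' ∧ (ρ (Fin.init b))⁻¹ = 0} = (∅ : Set (Fin (n + 1) → ℝ)) by
        ext b; simp only [mem_setOf_eq, mem_empty_iff_false, iff_false, not_and]
        exact fun hb h0 => by have := hinv1 b hb; linarith]
      exact measure_empty) hGlogInv with hLInv
  set F₃ : (Fin (n + 1 + 1) → ℝ) → ℝ := fun z => z (Fin.last (n + 1)) * (ρ (Fin.init (Fin.init z)) ^ 2)⁻¹
    with hF₃_def
  have hF₃s : IsSemialgebraicFunOn ℚ E F₃ :=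
    IsSemialgebraicFunOn.mul_holds hrE ((IsSemialgebraicFunOn.mul_holds hρE hρE).inv fun z hz => by
      have := hρ0 _ (hEx z hz); simp only [Pi.mul_apply]; positivity) |>.congr fun z _ => by
      simp [hF₃_def, sq]
  have hF₃d : ∀ z ∈ E, DifferentiableAt ℝ F₃ z := fun z hz => by
    obtain ⟨dρ, -, dr⟩ := hdiff_atoms z hz
    exact dr.mul ((dρ.pow 2).inv (pow_ne_zero 2 (hρ0 _ (hEx z hz)).ne'))
  have hF₃snoc : ∀ (b : Fin (n + 1) → ℝ) (t : ℝ), F₃ (Fin.snoc b t) = t * (ρ (Fin.init b) ^ 2)⁻¹ :=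
    fun b t => by simp only [hF₃_def, Fin.init_snoc, Fin.snoc_last]
  have hF₃deriv : ∀ z ∈ E, fderiv ℝ F₃ z (Pi.single (Fin.last (n + 1)) 1) = (ρ (Fin.init (Fin.init z)) ^ 2)⁻¹ :=
    fun z hz => fderiv_apply_single_last (hF₃d z hz).hasFDerivAt (by
      simp only [hF₃snoc]
      simpa using (hasDerivAt_id (z (Fin.last (n + 1)))).mul_const ((ρ (Fin.init (Fin.init z)) ^ 2)⁻¹))
  have hLInvd : LInv.domain = {z : Fin (n + 1 + 1) → ℝ | Fin.init z ∈ T' ∧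
      F₃ (Fin.snoc (Fin.init z) (p (Fin.init z))) < z (Fin.last (n + 1)) ∧
        z (Fin.last (n + 1)) < F₃ (Fin.snoc (Fin.init z) (q (Fin.init z)))} := by
    rw [show LInv.domain = logUnfoldDomain T' (fun b => (ρ (Fin.init b))⁻¹) from rfl,
      logUnfoldDomain_eq_of_one_le hinv1]
    ext z
    simp only [mem_setOf_eq, hF₃snoc, hp_def, hq_def]
    constructor
    · rintro ⟨hb, h1, h2⟩
      have h0 := (hρ0 _ hb.1).ne'
      refine ⟨hb, by rwa [mul_inv_cancel₀ (pow_ne_zero 2 h0)], ?_⟩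
      rwa [show ρ (Fin.init (Fin.init z)) * (ρ (Fin.init (Fin.init z)) ^ 2)⁻¹ = (ρ (Fin.init (Fin.init z)))⁻¹ by
        field_simp]
    · rintro ⟨hb, h1, h2⟩
      have h0 := (hρ0 _ hb.1).ne'
      refine ⟨hb, by rwa [mul_inv_cancel₀ (pow_ne_zero 2 h0)] at h1, ?_⟩
      rwa [show ρ (Fin.init (Fin.init z)) * (ρ (Fin.init (Fin.init z)) ^ 2)⁻¹ = (ρ (Fin.init (Fin.init z)))⁻¹ by
        field_simp] at h2
  set f₃ : (Fin (n + 1 + 1) → ℝ) → ℝ := fun z =>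
    h (Fin.init (Fin.init z)) / (1 + (Fin.init z) (Fin.last n) ^ 2) / z (Fin.last (n + 1)) with hf₃_def
  have hf₃s : IsSemialgebraicFunOn ℚ E f₃ :=
    IsSemialgebraicFunOn.div (IsSemialgebraicFunOn.div hhE h1s2 fun z _ => by positivity) hrE
      fun z hz => (hEr0 z hz).ne'
  obtain ⟨Q₃, hQ₃d, hQ₃i, -⟩ := exists_preimage_lastCoord hS hps hqs hpq LInv hF₃s
    (F' := fun z => fderiv ℝ F₃ z) (fun z hz => (hF₃d z hz).hasFDerivAt)
    (fun b _ => by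
      simp only [hF₃snoc]
      exact (continuous_id.mul continuous_const).continuousOn)
    (fun b hb => by
      simp only [hF₃snoc]
      intro x _ y _ hxy
      exact mul_lt_mul_of_pos_right hxy (by have := hρ0 _ hb.1; positivity))
    hLInvd hf₃s
    (fun z hz => by
      have hρ0' := hρ0 _ (hEx z hz)
      have hr0 := hEr0 z hz
      have h1 : 1 < z (Fin.last (n + 1)) * (ρ (Fin.init (Fin.init z)) ^ 2)⁻¹ := by
        rw [← div_eq_mul_inv, one_lt_div (by positivity)]
        exact hz.2.1
      rw [show LInv.integrand = logUnfoldIntegrand G from rfl, hF₃deriv z hz, abs_of_pos (by positivity),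
        logUnfoldIntegrand]
      simp only [Fin.init_snoc, Fin.snoc_last, hF₃_def, if_pos h1, one_mul, hf₃_def, hG_def]
      field_simp)
  ----------------------------------------------------------------
  -- C4: `[h c/((1 + c²s²) r)]` is carried onto `[G/r]` by the dilation `s ↦ c(r) s` (after
  -- swapping the coordinates `s` and `r`)
  ----------------------------------------------------------------
  set swapE : Equiv.Perm (Fin (n + 1 + 1)) := Equiv.swap (Fin.castSucc (Fin.last n)) (Fin.last (n + 1))
    with hswapE
  have hsw1 : swapE (Fin.castSucc (Fin.last n)) = Fin.last (n + 1) := by simp [hswapE]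
  have hsw2 : swapE (Fin.last (n + 1)) = Fin.castSucc (Fin.last n) := by simp [hswapE]
  have hsw3 : ∀ j : Fin n, swapE (Fin.castSucc (Fin.castSucc j)) = Fin.castSucc (Fin.castSucc j) := fun j => by
    rw [hswapE, Equiv.swap_apply_of_ne_of_ne]
    · exact fun h => (Fin.castSucc_lt_last j).ne (Fin.castSucc_injective _ h)
    · exact fun h => by
        have := congrArg Fin.val h
        simp at this
        omega
  -- reading the coordinates of `w ∘ swapE`
  have hσx : ∀ w : Fin (n + 1 + 1) → ℝ, Fin.init (Fin.init (fun i => w (swapE i))) = Fin.init (Fin.init w) :=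
    fun w => by funext j; simp only [Fin.init, hsw3]
  have hσs : ∀ w : Fin (n + 1 + 1) → ℝ, (Fin.init (fun i => w (swapE i))) (Fin.last n) = w (Fin.last (n + 1)) :=
    fun w => by simp only [Fin.init, hsw1]
  have hσσ : ∀ w : Fin (n + 1 + 1) → ℝ, (fun i => (fun j => w (swapE j)) (swapE i)) = w := fun w => by
    funext i; simp [hswapE, Equiv.swap_apply_self]
  set Q₃r := Q₃.reindex swapE with hQ₃r
  -- the swapped domain
  have hQ₃rd : ∀ w, w ∈ Q₃r.domain ↔ (Fin.init (Fin.init w) ∈ B ∧ w (Fin.last (n + 1)) ≠ 0) ∧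
      ρ (Fin.init (Fin.init w)) ^ 2 < (Fin.init w) (Fin.last n) ∧ (Fin.init w) (Fin.last n) < ρ (Fin.init (Fin.init w)) := by
    intro w
    rw [hQ₃r, IntegralRep.reindex_domain, mem_setOf_eq, hQ₃d]
    simp only [hT'_def, hp_def, hq_def, mem_setOf_eq]
    rw [hσx, hσs]
    simp only [hsw2, Fin.init]
  -- the dilation factor `K(x, r) = (1 + r)/(1 − r)` on the swapped base
  set K : (Fin (n + 1) → ℝ) → ℝ := fun b' => (1 + b' (Fin.last n)) / (1 - b' (Fin.last n)) with hK_def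
  have hTK : IsSemialgebraic ℚ {b' : Fin (n + 1) → ℝ | b' (Fin.last n) < 1} := by
    simpa using Literature.ModelTheory.ExponentialFields.isSemialgebraic_setOf_eval_lt (k := ℚ) (R := ℝ)
      (MvPolynomial.X (Fin.last n)) (1 : MvPolynomial (Fin (n + 1)) ℚ)
  have hKs : IsSemialgebraicFunOn ℚ {b' : Fin (n + 1) → ℝ | b' (Fin.last n) < 1} K := by
    have hl := isSemialgebraicFunOn_apply hTK (Fin.last n)
    have h1 := isSemialgebraicFunOn_ratCast hTK 1
    exact IsSemialgebraicFunOn.div ((IsSemialgebraicFunOn.add_holds h1 hl).congr fun b _ => by simp)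
      ((IsSemialgebraicFunOn.sub_holds h1 hl).congr fun b _ => by simp) fun b hb => by
        have : b (Fin.last n) < 1 := hb; exact by linarith
  have hQ₃rT : Q₃r.domain ⊆ {w | Fin.init w ∈ {b' : Fin (n + 1) → ℝ | b' (Fin.last n) < 1}} := fun w hw => by
    have hw' := (hQ₃rd w).1 hw
    exact hw'.2.2.trans (hρ1 _ hw'.1.1)
  have hKpos : ∀ w ∈ Q₃r.domain, 0 < K (Fin.init w) := fun w hw => by
    have hw' := (hQ₃rd w).1 hw
    have h0 : 0 < (Fin.init w) (Fin.last n) := lt_trans (by have := hρ0 _ hw'.1.1; positivity) hw'.2.1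
    have h1 : (Fin.init w) (Fin.last n) < 1 := hw'.2.2.trans (hρ1 _ hw'.1.1)
    simp only [hK_def]
    exact div_pos (by linarith) (by linarith)
  have hKd : ∀ w ∈ Q₃r.domain, DifferentiableAt ℝ K (Fin.init w) := fun w hw => by
    have hw' := (hQ₃rd w).1 hw
    have h1 : 1 - (Fin.init w) (Fin.last n) ≠ 0 := by have := hw'.2.2.trans (hρ1 _ hw'.1.1); linarith
    have hl : DifferentiableAt ℝ (fun b' : Fin (n + 1) → ℝ => b' (Fin.last n)) (Fin.init w) :=
      differentiableAt_apply (𝕜 := ℝ) _ _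
    simp only [hK_def, div_eq_mul_inv]
    exact ((differentiableAt_const _).add hl).mul (((differentiableAt_const _).sub hl).inv h1)
  have hf₃σ : ∀ v : Fin (n + 1 + 1) → ℝ, f₃ (fun i => v (swapE i)) =
      h (Fin.init (Fin.init v)) / (1 + v (Fin.last (n + 1)) ^ 2) / (Fin.init v) (Fin.last n) := fun v => by
    simp only [hf₃_def]
    rw [hσx, hσs]
    simp only [hsw2, Fin.init]
  obtain ⟨dmap, dder, dinj⟩ := lastCoord_covData_basic (m := n + 1) Q₃r.isSemialgebraic_domain
    (isSemialgebraicFunOn_dilation hKs Q₃r.isSemialgebraic_domain hQ₃rT)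
    (F' := fun w => fderiv ℝ (fun w : Fin (n + 1 + 1) → ℝ => K (Fin.init w) * w (Fin.last (n + 1))) w)
    (fun w hw => (differentiableAt_dilation (hKd w hw)).hasFDerivAt)
    (fun w₁ _ w₂ hw₂ hi hm => by
      rw [hi] at hm
      have := mul_left_cancel₀ (hKpos w₂ hw₂).ne' hm
      rw [← Fin.snoc_init_self w₁, ← Fin.snoc_init_self w₂, hi, this])
  have himg : (fun w => (Fin.snoc (Fin.init w) (K (Fin.init w) * w (Fin.last (n + 1))) : Fin (n + 1 + 1) → ℝ)) ''
      Q₃r.domain = Q₃r.domain := by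
    ext w
    simp only [mem_image]
    constructor
    · rintro ⟨v, hv, rfl⟩
      have hv' := (hQ₃rd v).1 hv
      rw [hQ₃rd]
      simp only [Fin.init_snoc, Fin.snoc_last]
      exact ⟨⟨hv'.1.1, mul_ne_zero (hKpos v hv).ne' hv'.1.2⟩, hv'.2⟩
    · intro hw
      have hw' := (hQ₃rd w).1 hw
      have hKw := hKpos w hw
      refine ⟨Fin.snoc (Fin.init w) (w (Fin.last (n + 1)) / K (Fin.init w)), ?_, ?_⟩
      · rw [hQ₃rd]
        simp only [Fin.init_snoc, Fin.snoc_last]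
        exact ⟨⟨hw'.1.1, div_ne_zero hw'.1.2 hKw.ne'⟩, hw'.2⟩
      · simp only [Fin.init_snoc, Fin.snoc_last]
        rw [mul_div_cancel₀ _ hKw.ne', Fin.snoc_init_self]
  set f₂r : (Fin (n + 1 + 1) → ℝ) → ℝ := fun w =>
    h (Fin.init (Fin.init w)) / (1 + (K (Fin.init w) * w (Fin.last (n + 1))) ^ 2) /
      (Fin.init w) (Fin.last n) * K (Fin.init w) with hf₂r_def
  have hf₂rs : IsSemialgebraicFunOn ℚ Q₃r.domain f₂r := by
    have hD := Q₃r.isSemialgebraic_domain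
    have hKw : IsSemialgebraicFunOn ℚ Q₃r.domain (fun w => K (Fin.init w)) := hKs.comp_init.mono hQ₃rT hD
    have hhw : IsSemialgebraicFunOn ℚ Q₃r.domain (fun w => h (Fin.init (Fin.init w))) :=
      hh.comp_init.comp_init.mono (fun w hw => ((hQ₃rd w).1 hw).1.1) hD
    have hl := isSemialgebraicFunOn_apply hD (Fin.last (n + 1))
    have hr : IsSemialgebraicFunOn ℚ Q₃r.domain (fun w : Fin (n + 1 + 1) → ℝ => (Fin.init w) (Fin.last n)) :=
      (isSemialgebraicFunOn_apply hD (Fin.castSucc (Fin.last n))).congr fun z _ => by simp [Fin.init]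
    have h1 := isSemialgebraicFunOn_ratCast hD 1
    have hks := IsSemialgebraicFunOn.mul_holds hKw hl
    have hden : IsSemialgebraicFunOn ℚ Q₃r.domain (fun w => 1 + (K (Fin.init w) * w (Fin.last (n + 1))) ^ 2) :=
      (IsSemialgebraicFunOn.add_holds h1 (IsSemialgebraicFunOn.mul_holds hks hks)).congr fun w _ => by simp [sq]
    have hA : IsSemialgebraicFunOn ℚ Q₃r.domain (fun w =>
        h (Fin.init (Fin.init w)) / (1 + (K (Fin.init w) * w (Fin.last (n + 1))) ^ 2)) :=
      IsSemialgebraicFunOn.div hhw hden fun w _ => by positivity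
    have hBq : IsSemialgebraicFunOn ℚ Q₃r.domain (fun w =>
        h (Fin.init (Fin.init w)) / (1 + (K (Fin.init w) * w (Fin.last (n + 1))) ^ 2) / (Fin.init w) (Fin.last n)) :=
      IsSemialgebraicFunOn.div hA hr fun w hw => by
        have hw' := (hQ₃rd w).1 hw
        exact (lt_trans (by have := hρ0 _ hw'.1.1; positivity) hw'.2.1).ne'
    exact (IsSemialgebraicFunOn.mul_holds hBq hKw).congr fun w _ => by simp [hf₂r_def]
  obtain ⟨Q₂r, hQ₂rd, hQ₂ri, ecov⟩ := exists_preimage_rep Q₃r Q₃r.isSemialgebraic_domain dmap dder dinj himg hf₂rs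
    (fun w hw => by
      rw [det_lastCoordDeriv, fderiv_dilation_single (hKd w hw), abs_of_pos (hKpos w hw), hQ₃r,
        IntegralRep.reindex_integrand, hQ₃i]
      show f₂r w = f₃ (fun i => (Fin.snoc (Fin.init w) (K (Fin.init w) * w (Fin.last (n + 1))) :
        Fin (n + 1 + 1) → ℝ) (swapE i)) * K (Fin.init w)
      rw [hf₃σ]
      simp only [Fin.init_snoc, Fin.snoc_last, hf₂r_def])
  set Q₂ := Q₂r.reindex swapE with hQ₂
  have eQ₂₃ : of Q₂ - of Q₃ ∈ S := by
    have e1 := of_sub_of_reindex_mem hS Q₃ swapE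
    have e2 := of_sub_of_reindex_mem hS Q₂r swapE
    have e3 : of Q₂r - of Q₃r ∈ S := mem_of_mem_changeOfVariablesRel hS ecov
    have : of Q₂ - of Q₃ = -(of Q₂r - of Q₂) + (of Q₂r - of Q₃r) - (of Q₃ - of Q₃r) := by abel
    rw [this]
    exact S.sub_mem (S.add_mem (S.neg_mem e2) e3) e1
  have hQ₂d : Q₂.domain = E := by
    ext z
    rw [hQ₂, IntegralRep.reindex_domain, mem_setOf_eq, hQ₂rd, hQ₃r, IntegralRep.reindex_domain, mem_setOf_eq,
      hσσ, hQ₃d]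
  have hQ₂i : ∀ z ∈ E, Q₂.integrand z = h (Fin.init (Fin.init z)) *
      ((1 + z (Fin.last (n + 1))) / (1 - z (Fin.last (n + 1)))) /
        ((1 + ((1 + z (Fin.last (n + 1))) / (1 - z (Fin.last (n + 1)))) ^ 2 * (Fin.init z) (Fin.last n) ^ 2) *
          z (Fin.last (n + 1))) := fun z hz => by
    rw [hQ₂, IntegralRep.reindex_integrand, hQ₂ri]
    simp only [hf₂r_def, hK_def]
    rw [hσx]
    simp only [Fin.init, hsw1, hsw2]
    have hr0 := (hEr0 z hz).ne'
    have h1 : 1 - z (Fin.last (n + 1)) ≠ 0 := by have := hEr1 z hz; linarith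
    field_simp
  ----------------------------------------------------------------
  -- C5: integrand additivity and assembly
  ----------------------------------------------------------------
  set Q₁₃ : IntegralRep (n + 1 + 1) :=
    { domain := E
      integrand := fun z => f₁ z + f₃ z
      isSemialgebraic_domain := hEs
      isSemialgebraicFunOn_integrand := IsSemialgebraicFunOn.add_holds hf₁s hf₃s
      integrableOn := by
        have h1 := Q₁.integrableOn; rw [hQ₁d, hQ₁i] at h1
        have h3 := Q₃.integrableOn; rw [hQ₃d, hQ₃i] at h3
        exact h1.add h3 } with hQ₁₃
  have hQ₁₃i : Q₁₃.integrand = fun z => f₁ z + f₃ z := rfl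
  have e13 : of Q₁₃ - of Q₁ - of Q₃ ∈ S :=
    of_sub_of_sub_mem_of_add hS hQ₁d hQ₃d (fun z _ => by rw [hQ₁i, hQ₃i]; rfl)
  have e1b : of Rfull - of Q₁₃ - of Q₂.neg ∈ S := by
    refine of_sub_of_sub_mem_of_add hS (by rw [hRfd]) (by rw [IntegralRep.domain_neg, hQ₂d, hRfd]) (fun z hz => ?_)
    have hz' : z ∈ E := by rw [hRfd] at hz; exact hz
    rw [hRfi, Pi.add_apply, IntegralRep.integrand_neg, Pi.neg_apply, hQ₂i z hz', hQ₁₃i]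
    simp only [hfR_def, hf₁_def, hf₃_def]
    ring
  have eneg : of Q₂ + of Q₂.neg ∈ S := of_add_of_neg_mem hS Q₂
  have : of Rband - of LM = -(of Rfull - of Rband) + (of Rfull - of Q₁₃ - of Q₂.neg) + (of Q₁₃ - of Q₁ - of Q₃) +
      (of Q₁ - of LM) - (of Q₂ - of Q₃) + (of Q₂ + of Q₂.neg) := by abel
  rw [this]
  exact S.add_mem (S.sub_mem (S.add_mem (S.add_mem (S.add_mem (S.neg_mem eFull) e1b) e13) eQ₁) eQ₂₃) eneg

end Summit.KontsevichZagierPeriods.K2SymbolChains.JensenIsScissorsProof
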